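import Mathlib
import Summits.AtomisticToContinuum.HydrodynamicLimit.Theorems.ImplosionDichotomyDenseExcursionSonicCavityDefsB

/-!
# Complex-conjugation symmetry of smooth radial modes and of the sonic-slaving inequality
# (crux `DenseExcursion`, line `sonic-cavity-renewal` v7, brick (M4)-(P6) for the registered stub `stub_sonicSlaving`)

Helper file (`--supports stmt-AtomisticToContinuum-12586`, line lead a2, stub-worker A (wave 3) for `stub_sonicSlaving`).

The mode equations `Λ ŵ = linW`, `Λ ŝ = linS` (`…R2Modes`) have REAL coefficients, so the complex conjugate of a smooth radial mode is a
smooth radial mode for the conjugate rate (`isSmoothRadialMode_conj`), the slaving coefficient and the p-wave content observable of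
`…SonicCavityDefsB` transform by conjugation (`slavingCoeff_conj`, `pWaveContent_conj`), and therefore `SonicSlaving` — whose
inequality only sees `Re Λ`, `|Im Λ|` and norms — follows from its restriction to rates in the UPPER half-plane
(`sonicSlaving_of_pos_im`, registered helper). The contour-transport proof of `stub_sonicSlaving` (worker report
`work/stubs/A_sonicSlaving.REPORT.md`) runs one counter-clockwise loop for `Im Λ > boxTop`; this file supplies the other sign.
Pure algebra; no citation is load-bearing.
-/

noncomputable section

open Set ComplexConjugate
open scoped ContDiff

namespace Summit.AtomisticToContinuum.HydrodynamicLimit.Theorems.SonicCavityRenewal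

open Summit.AtomisticToContinuum.HydrodynamicLimit.Theorems.R2OneModeTwoConditions

/-- The derivative of the conjugate of a differentiable `ℝ → ℂ` function is the conjugate of the derivative. [folklore] -/
theorem deriv_conj_of_differentiable {f : ℝ → ℂ} (hf : Differentiable ℝ f) (x : ℝ) :
    deriv (fun y => conj (f y)) x = conj (deriv f x) :=
  ((hf x).hasDerivAt.star).deriv

/-- The conjugate of a `C^∞` function `ℝ → ℂ` is `C^∞`. [folklore] -/
theorem contDiff_conj_comp {f : ℝ → ℂ} (hf : ContDiff ℝ ∞ f) : ContDiff ℝ ∞ (fun y => conj (f y)) :=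
  Complex.conjCLE.contDiff.comp hf

/-- `linW`, `linS` commute with conjugation of the unknowns (real coefficients). [folklore] -/
theorem lin_conj {r : ℝ} {W S : ℝ → ℝ} {ŵ ŝ : ℝ → ℂ} (hŵ : Differentiable ℝ ŵ) (hŝ : Differentiable ℝ ŝ) (x : ℝ) :
    linW r W S (fun y => conj (ŵ y)) (fun y => conj (ŝ y)) x = conj (linW r W S ŵ ŝ x) ∧
      linS r W S (fun y => conj (ŵ y)) (fun y => conj (ŝ y)) x = conj (linS r W S ŵ ŝ x) := by
  unfold linW linS
  rw [deriv_conj_of_differentiable hŵ, deriv_conj_of_differentiable hŝ]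
  simp only [map_add, map_mul, Complex.conj_ofReal]
  exact ⟨trivial, trivial⟩

/-- Centre-regularity is preserved by conjugation (the `ℝ³`-extensions of the real parts are unchanged, those of the imaginary parts
change sign). [folklore] -/
theorem isRegularPair_conj {ŵ ŝ : ℝ → ℂ} (h : IsRegularPair ŵ ŝ) : IsRegularPair (fun y => conj (ŵ y)) (fun y => conj (ŝ y)) := by
  obtain ⟨hŵ, hŝ, F₁, F₂, G₁, G₂, hF₁, hF₂, hG₁, hG₂, hext⟩ := h
  refine ⟨contDiff_conj_comp hŵ, contDiff_conj_comp hŝ, F₁, fun y => -F₂ y, G₁, fun y => -G₂ y, hF₁, hF₂.neg, hG₁, hG₂.neg,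
    fun y hy => ?_⟩
  obtain ⟨e1, e2, e3, e4⟩ := hext y hy
  refine ⟨by simpa using e1, ?_, by simpa using e3, ?_⟩
  · rw [Complex.conj_im, neg_smul, e2]
  · rw [Complex.conj_im, mul_neg, e4]

/-- **The conjugate of a smooth radial mode is a smooth radial mode for the conjugate rate.** [folklore] -/
theorem isSmoothRadialMode_conj {r : ℝ} {W S : ℝ → ℝ} {Λ : ℂ} {ŵ ŝ : ℝ → ℂ} (h : IsSmoothRadialMode r W S Λ ŵ ŝ) :
    IsSmoothRadialMode r W S (conj Λ) (fun y => conj (ŵ y)) (fun y => conj (ŝ y)) := by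
  obtain ⟨hreg, ⟨x₀, hx₀⟩, heq⟩ := h
  have hŵ : Differentiable ℝ ŵ := hreg.1.differentiable (by simp)
  have hŝ : Differentiable ℝ ŝ := hreg.2.1.differentiable (by simp)
  refine ⟨isRegularPair_conj hreg, ⟨x₀, ?_⟩, fun x => ?_⟩
  · rcases hx₀ with h | h
    · exact Or.inl fun h' => h (by simpa using congrArg conj h')
    · exact Or.inr fun h' => h (by simpa using congrArg conj h')
  · obtain ⟨l1, l2⟩ := lin_conj (r := r) (W := W) (S := S) hŵ hŝ x
    obtain ⟨e1, e2⟩ := heq x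
    rw [l1, l2, ← map_mul, ← map_mul, e1, e2]
    exact ⟨rfl, rfl⟩

/-- The slaving coefficient transforms by conjugation of the rate (all other entries are real). [folklore] -/
theorem slavingCoeff_conj (r : ℝ) (W S : ℝ → ℝ) (Λ : ℂ) (x : ℝ) :
    slavingCoeff r W S (conj Λ) x = conj (slavingCoeff r W S Λ x) := by
  unfold slavingCoeff
  simp only [map_div₀, map_sub, map_mul, Complex.conj_ofReal]

/-- The p-wave content of the conjugate mode at the conjugate rate is the conjugate p-wave content. [folklore] -/
theorem pWaveContent_conj (r : ℝ) (W S : ℝ → ℝ) (Λ : ℂ) (ŵ ŝ : ℝ → ℂ) :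
    pWaveContent r W S (conj Λ) (fun y => conj (ŵ y)) (fun y => conj (ŝ y)) = conj (pWaveContent r W S Λ ŵ ŝ) := by
  unfold pWaveContent
  rw [slavingCoeff_conj]
  simp only [map_sub, map_add, map_mul, map_ofNat]

/-- **`SonicSlaving` FOLLOWS FROM ITS UPPER-HALF-PLANE CASE** — registered helper `sonicSlaving_of_pos_im` for `stub_sonicSlaving`. If
the slaving inequality `|Im Λ|·‖D‖ ≤ 2‖m(x_m)‖` holds for every smooth radial mode with `−1/4 < Re Λ ≤ boxSide` and `Im Λ > boxTop`,
it holds for `|Im Λ| > boxTop` (apply the hypothesis to the conjugate mode at `conj Λ`; the two sides are conjugation invariant).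
[folklore] -/
theorem sonicSlaving_of_pos_im : ∀ (r : ℝ) (W S : ℝ → ℝ), (∀ (Λ : ℂ) (ŵ ŝ : ℝ → ℂ), IsSmoothRadialMode r W S Λ ŵ ŝ → -(1 / 4 : ℝ) < Λ.re → Λ.re ≤ boxSide → boxTop < Λ.im → |Λ.im| * ‖pWaveContent r W S Λ ŵ ŝ‖ ≤ 2 * ‖ŵ matchPoint - 3 * ŝ matchPoint‖) → SonicSlaving r W S := by
  intro r W S h Λ ŵ ŝ hmode hre hside him
  rcases lt_or_ge 0 Λ.im with hpos | hnonpos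
  · rw [abs_of_pos hpos] at him
    exact h Λ ŵ ŝ hmode hre hside him
  · -- `Im Λ ≤ 0`: pass to the conjugate mode
    have him' : boxTop < (conj Λ).im := by
      rw [Complex.conj_im]
      rwa [abs_of_nonpos hnonpos] at him
    have key := h (conj Λ) (fun y => conj (ŵ y)) (fun y => conj (ŝ y)) (isSmoothRadialMode_conj hmode)
      (by simpa using hre) (by simpa using hside) him'
    rw [pWaveContent_conj, Complex.norm_conj, Complex.conj_im, abs_neg] at key
    have hn : ‖conj (ŵ matchPoint) - 3 * conj (ŝ matchPoint)‖ = ‖ŵ matchPoint - 3 * ŝ matchPoint‖ := by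
      rw [← Complex.norm_conj (ŵ matchPoint - 3 * ŝ matchPoint)]
      simp only [map_sub, map_mul, map_ofNat]
    rwa [hn] at key

end Summit.AtomisticToContinuum.HydrodynamicLimit.Theorems.SonicCavityRenewal

end
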